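import Literature.NumberTheory.LFunctions.TuringMethod

/-!
# Turing's method from below: lower bounds for `N(T)` and exact counts at a single height

`Literature.NumberTheory.LFunctions.TuringMethod` proves the UPPER half of Turing's method
(`zetaZeroCount_le_of_turing`: found zeros in `(T, T + h]` and a bound `∫_T^{T+h} S ≤ B` give
`N(T) ≤ n`). This file proves the mirror-image LOWER half (found zeros in `(T − h, T]` and a bound
`−B ≤ ∫_{T−h}^{T} S` give `n < N(T)`), which is the direction Turing's method supplies at the TOP of
a chain of Gram blocks (`N(g_p) ≥ p + 1` in Brent 1979, Theorem 3.2; Lehman 1970), and assembles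
the two halves into an exact count `N(T) = n` at a single height `T` from strict sign changes of
Hardy's `Z` in a window `[T − h', T + h]` — the shape of a "window certificate" that pins a printed
count such as `N(32 585 736.4) = 75 000 000` (Brent 1979) or `N(545 439 823.215) = 1 500 000 001`
(van de Lune–te Riele–Winter 1986) without any data below the window.

## Main results (namespace `Literature.NumberTheory.LFunctions`)

(Helpers — the IVT step, the counting function `#{γ ∈ Z | t < γ}` and its integral — are private,
as in `TuringMethod`.)

* `turing_lehman_upper_bound`: for found zeros `Z ⊂ (T − h, T]` on the critical line,
  `∫_{T−h}^{T} S ≤ h · N(T) − Σ_{γ ∈ Z} (γ − (T − h)) − ∫_{T−h}^{T} (θ/π + 1)`.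
* `lt_zetaZeroCount_of_turing_lower`: with `−B ≤ ∫_{T−h}^{T} S` and
  `h · n < Σ_{γ ∈ Z} (γ − (T − h)) + ∫_{T−h}^{T} (θ/π + 1) − B`, one has `n < N(T)`.
* `zetaZeroCount_eq_of_turing_window`: both halves, fed by sign changes of `Z` and a two-sided
  bound `|∫_{t₁}^{t₂} S| ≤ A(t₂)` (`t₁ > c`), give `N(T) = n`.
* `zetaZeroCount_eq_of_turing_window_trudgian`: the same with Trudgian 2011, Thm. 2.2
  (`abs_integral_zetaArgS_le_trudgian`) plugged in.

[cite: EdwardsZeta1974, §8.2]; [cite: Brent1979, Thm. 3.2]; [cite: Trudgian2011, Thm. 2.2]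
-/

open Complex Set MeasureTheory intervalIntegral
open scoped Real

namespace Literature.NumberTheory.LFunctions

/-! ### Sign changes locate zeros (non-private restatement of the IVT step) -/

/-- **Sign changes locate zeros (IVT), indexed form.** If a continuous `f : ℝ → ℝ` has strict
sign changes `f(t_i) f(t_{i+1}) < 0` along `t_0 < ⋯ < t_k`, there are zeros `c_0 < ⋯ < c_{k-1}`
with `t_i < c_i < t_{i+1}`. (Same statement as the private lemma of `TuringMethod`.) [folklore] -/
private theorem exists_strictMono_zeros_of_sign_changes' {f : ℝ → ℝ} (hf : Continuous f) {k : ℕ}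
    (t : Fin (k + 1) → ℝ) (ht : StrictMono t)
    (hsign : ∀ i : Fin k, f (t i.castSucc) * f (t i.succ) < 0) :
    ∃ c : Fin k → ℝ, StrictMono c ∧ ∀ i, f (c i) = 0 ∧ t i.castSucc < c i ∧ c i < t i.succ := by
  have hzero : ∀ i : Fin k, ∃ c, f c = 0 ∧ t i.castSucc < c ∧ c < t i.succ := by
    intro i
    have hlt : t i.castSucc < t i.succ := ht Fin.castSucc_lt_succ
    have h0 : (0 : ℝ) ∈ uIcc (f (t i.castSucc)) (f (t i.succ)) := by
      rcases mul_neg_iff.1 (hsign i) with ⟨h1, h2⟩ | ⟨h1, h2⟩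
      · exact mem_uIcc.2 (Or.inr ⟨h2.le, h1.le⟩)
      · exact mem_uIcc.2 (Or.inl ⟨h1.le, h2.le⟩)
    obtain ⟨c, hc, hfc⟩ := intermediate_value_uIcc hf.continuousOn h0
    rw [uIcc_of_le hlt.le] at hc
    have hne1 : c ≠ t i.castSucc := by
      rintro rfl
      exact (mul_neg_iff.1 (hsign i)).elim (fun h ↦ h.1.ne' hfc) (fun h ↦ h.1.ne hfc)
    have hne2 : c ≠ t i.succ := by
      rintro rfl
      exact (mul_neg_iff.1 (hsign i)).elim (fun h ↦ h.2.ne hfc) (fun h ↦ h.2.ne' hfc)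
    exact ⟨c, hfc, lt_of_le_of_ne hc.1 hne1.symm, lt_of_le_of_ne hc.2 hne2⟩
  choose c hc using hzero
  refine ⟨c, ?_, hc⟩
  intro i j hij
  calc c i < t i.succ := (hc i).2.2
    _ ≤ t j.castSucc := ht.monotone (by
        rw [Fin.le_iff_val_le_val, Fin.val_succ, Fin.val_castSucc]; exact hij)
    _ < c j := (hc j).2.1

/-! ### The counting function of found zeros, seen from above -/

/-- The step `t ↦ [t < γ]` is antitone. [folklore] -/
private theorem antitone_ite_gt (γ : ℝ) : Antitone fun t : ℝ ↦ if t < γ then (1 : ℝ) else 0 := by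
  intro x y hxy
  by_cases hy : y < γ
  · have hx : x < γ := lt_of_le_of_lt hxy hy
    simp [hx, hy]
  · by_cases hx : x < γ <;> simp [hx, hy]

/-- `∫_a^b [t < γ] dt = γ − a` for `a ≤ γ ≤ b`. [folklore] -/
private theorem integral_ite_gt {a b γ : ℝ} (ha : a ≤ γ) (hb : γ ≤ b) :
    ∫ t in a..b, (if t < γ then (1 : ℝ) else 0) = γ - a := by
  have hi : ∀ c d, IntervalIntegrable (fun t : ℝ ↦ if t < γ then (1 : ℝ) else 0) volume c d :=
    fun c d ↦ (antitone_ite_gt γ).intervalIntegrable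
  rw [← intervalIntegral.integral_add_adjacent_intervals (hi a γ) (hi γ b)]
  have hae : ∀ᵐ t ∂(volume : Measure ℝ), t ≠ γ := by
    have h0 : (volume : Measure ℝ) {γ} = 0 := measure_singleton γ
    exact (measure_eq_zero_iff_ae_notMem.1 h0).mono fun t ht h ↦ ht (by simp [h])
  have h1 : ∫ t in a..γ, (if t < γ then (1 : ℝ) else 0) = ∫ _ in a..γ, (1 : ℝ) := by
    refine intervalIntegral.integral_congr_ae ?_
    filter_upwards [hae] with t hne ht
    rw [uIoc_of_le ha] at ht
    simp [lt_of_le_of_ne ht.2 hne]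
  have h2 : ∫ t in γ..b, (if t < γ then (1 : ℝ) else 0) = ∫ _ in γ..b, (0 : ℝ) := by
    refine intervalIntegral.integral_congr_ae (Filter.Eventually.of_forall fun t ht ↦ ?_)
    rw [uIoc_of_le hb] at ht
    simp [not_lt.2 ht.1.le]
  rw [h1, h2]
  simp

/-- The number of found zeros above `t`, `#{γ ∈ Z | t < γ}`, integrates over `[T − h, T]` to
`Σ_{γ ∈ Z} (γ − (T − h))` when all `γ ∈ (T − h, T]`. [folklore] -/
private theorem integral_card_filter_gt {T h : ℝ} (Z : Finset ℝ) (hZ : ∀ γ ∈ Z, T - h < γ ∧ γ ≤ T) :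
    ∫ t in (T - h)..T, ((Z.filter (t < ·)).card : ℝ) = ∑ γ ∈ Z, (γ - (T - h)) := by
  simp_rw [Finset.natCast_card_filter]
  rw [intervalIntegral.integral_finsetSum fun γ _ ↦ (antitone_ite_gt γ).intervalIntegrable]
  exact Finset.sum_congr rfl fun γ hγ ↦ integral_ite_gt (hZ γ hγ).1.le (hZ γ hγ).2

/-- The counting function `t ↦ #{γ ∈ Z | t < γ}` is antitone. [folklore] -/
private theorem antitone_card_filter_gt (Z : Finset ℝ) :
    Antitone fun t : ℝ ↦ ((Z.filter (t < ·)).card : ℝ) := by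
  intro x y hxy
  have hsub : Z.filter (y < ·) ⊆ Z.filter (x < ·) := fun γ hγ ↦ by
    rw [Finset.mem_filter] at hγ ⊢
    exact ⟨hγ.1, hxy.trans_lt hγ.2⟩
  have h := Finset.card_le_card hsub
  dsimp only
  exact_mod_cast h

/-- Pointwise: `N(t) + #{γ ∈ Z | t < γ} ≤ N(T)` for `0 ≤ t ≤ T`, when `Z` consists of ordinates
`γ ≤ T` of zeros of `ζ` on the critical line. [folklore] -/
private theorem zetaZeroCount_add_card_filter_gt_le {T t : ℝ} (ht : 0 ≤ t) (htT : t ≤ T) (Z : Finset ℝ)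
    (hZ : ∀ γ ∈ Z, riemannZeta (1 / 2 + γ * I) = 0 ∧ γ ≤ T) :
    (zetaZeroCount t : ℝ) + ((Z.filter (t < ·)).card : ℝ) ≤ zetaZeroCount T := by
  have h := zetaZeroCount_add_card_le ht htT (Z.filter (t < ·)) fun γ hγ ↦ by
    rw [Finset.mem_filter] at hγ
    exact ⟨(hZ γ hγ.1).1, hγ.2, (hZ γ hγ.1).2⟩
  exact_mod_cast h

/-! ### The Turing–Lehman inequality from above and Turing's method from below -/

/-- **The Turing–Lehman inequality on `[T − h, T]`.** Let `0 ≤ T − h`, `0 ≤ h`, and let `Z` be a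
finite set of ordinates `γ ∈ (T − h, T]` of zeros of `ζ` on the critical line ("found zeros").
Since `N(t) ≤ N(T) − #{γ ∈ Z | t < γ}` on `[T − h, T]` and `S = N − θ/π − 1`,
`∫_{T−h}^{T} S(t) dt ≤ h · N(T) − Σ_{γ ∈ Z} (γ − (T − h)) − ∫_{T−h}^{T} (θ(t)/π + 1) dt`.
(The mirror image of `turing_lehman_lower_bound`; Lehman 1970 / Brent 1979 use it at `T = g_p`.)
[cite: Brent1979, Thm. 3.2] -/
theorem turing_lehman_upper_bound {T h : ℝ} (hTh : 0 ≤ T - h) (hh : 0 ≤ h) (Z : Finset ℝ)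
    (hZ : ∀ γ ∈ Z, riemannZeta (1 / 2 + γ * I) = 0 ∧ T - h < γ ∧ γ ≤ T) :
    ∫ t in (T - h)..T, zetaArgS t
      ≤ h * zetaZeroCount T - ∑ γ ∈ Z, (γ - (T - h))
        - ∫ t in (T - h)..T, (riemannSiegelTheta t / π + 1) := by
  set F : ℝ → ℝ := fun t ↦ ((Z.filter (t < ·)).card : ℝ) with hF
  have hle : T - h ≤ T := by linarith
  have hFi : IntervalIntegrable F volume (T - h) T := (antitone_card_filter_gt Z).intervalIntegrable
  have hθi : IntervalIntegrable (fun t ↦ riemannSiegelTheta t / π + 1) volume (T - h) T :=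
    ((intervalIntegrable_riemannSiegelTheta (T - h) T).div_const π).add
      (intervalIntegrable_const (c := (1 : ℝ)))
  have hci : IntervalIntegrable (fun _ ↦ (zetaZeroCount T : ℝ)) volume (T - h) T :=
    intervalIntegrable_const
  have hfi : IntervalIntegrable
      (fun t ↦ (zetaZeroCount T : ℝ) - F t - (riemannSiegelTheta t / π + 1)) volume (T - h) T :=
    (hci.sub hFi).sub hθi
  have hmono : ∫ t in (T - h)..T, zetaArgS t
      ≤ ∫ t in (T - h)..T, ((zetaZeroCount T : ℝ) - F t - (riemannSiegelTheta t / π + 1)) := by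
    refine intervalIntegral.integral_mono_on hle (intervalIntegrable_zetaArgS _ _) hfi
      fun t ht ↦ ?_
    have := zetaZeroCount_add_card_filter_gt_le (hTh.trans ht.1) ht.2 Z
      fun γ hγ ↦ ⟨(hZ γ hγ).1, (hZ γ hγ).2.2⟩
    simp only [zetaArgS, hF]
    linarith
  have hcalc : ∫ t in (T - h)..T, ((zetaZeroCount T : ℝ) - F t - (riemannSiegelTheta t / π + 1))
      = h * zetaZeroCount T - ∑ γ ∈ Z, (γ - (T - h))
        - ∫ t in (T - h)..T, (riemannSiegelTheta t / π + 1) := by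
    rw [intervalIntegral.integral_sub (hci.sub hFi) hθi, intervalIntegral.integral_sub hci hFi,
      intervalIntegral.integral_const, hF, integral_card_filter_gt Z fun γ hγ ↦ (hZ γ hγ).2]
    simp only [smul_eq_mul]
    ring
  linarith [hmono, hcalc]

/-- **Turing's method from below.** Let `0 ≤ T − h`, `0 ≤ h`, let `Z` be a finite set of
ordinates `γ ∈ (T − h, T]` of zeros of `ζ` on the critical line, and suppose
`−B ≤ ∫_{T−h}^{T} S(t) dt`. If `h · n < Σ_{γ ∈ Z} (γ − (T − h)) + ∫_{T−h}^{T} (θ/π + 1) − B`, then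
`n < N(T)`. (Brent 1979, Thm. 3.2 gives the Gram-block instance `N(g_p) ≥ p + 1`.)
[cite: Brent1979, Thm. 3.2] -/
theorem lt_zetaZeroCount_of_turing_lower {T h B : ℝ} {n : ℕ} (hTh : 0 ≤ T - h) (hh : 0 ≤ h)
    (Z : Finset ℝ) (hZ : ∀ γ ∈ Z, riemannZeta (1 / 2 + γ * I) = 0 ∧ T - h < γ ∧ γ ≤ T)
    (hS : -B ≤ ∫ t in (T - h)..T, zetaArgS t)
    (hnum : h * n < ∑ γ ∈ Z, (γ - (T - h))
        + (∫ t in (T - h)..T, (riemannSiegelTheta t / π + 1)) - B) :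
    n < zetaZeroCount T := by
  by_contra hle
  rw [not_lt] at hle
  have h1 : (zetaZeroCount T : ℝ) ≤ n := by exact_mod_cast hle
  have h2 : h * (zetaZeroCount T : ℝ) ≤ h * n := mul_le_mul_of_nonneg_left h1 hh
  have h3 := turing_lehman_upper_bound hTh hh Z hZ
  linarith

/-- Found zeros below `T` from sign changes: if `Z` has strict sign changes along
`T − h ≤ s_0 < s_1 < ⋯ < s_m ≤ T`, there is a set of ordinates `γ_j ∈ (s_j, s_{j+1})` of zeros
of `ζ` on the critical line with `Σ_j (s_j − (T − h)) ≤ Σ_{γ} (γ − (T − h))`.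
(A zero of `Z` is a zero of `ζ` on the line: `hardyZ_eq_zero_iff_holds`.) [folklore] -/
private theorem exists_finset_zeros_below_of_sign_changes {T h : ℝ} {m : ℕ}
    (s : Fin (m + 1) → ℝ) (hs : StrictMono s) (hs0 : T - h ≤ s 0) (hsm : s (Fin.last m) ≤ T)
    (hsign : ∀ i : Fin m, hardyZ (s i.castSucc) * hardyZ (s i.succ) < 0) :
    ∃ Z : Finset ℝ, (∀ γ ∈ Z, riemannZeta (1 / 2 + γ * I) = 0 ∧ T - h < γ ∧ γ ≤ T) ∧
      ∑ i : Fin m, (s i.castSucc - (T - h)) ≤ ∑ γ ∈ Z, (γ - (T - h)) := by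
  classical
  obtain ⟨c, hcmono, hc⟩ := exists_strictMono_zeros_of_sign_changes' continuous_hardyZ s hs hsign
  refine ⟨Finset.univ.image c, ?_, ?_⟩
  · intro γ hγ
    rw [Finset.mem_image] at hγ
    obtain ⟨i, -, rfl⟩ := hγ
    refine ⟨(hardyZ_eq_zero_iff_holds _).1 (hc i).1, ?_, ?_⟩
    · exact hs0.trans_lt ((hs.monotone (Fin.zero_le _)).trans_lt (hc i).2.1)
    · exact ((hc i).2.2.le.trans (hs.monotone (Fin.le_last _))).trans hsm
  · rw [Finset.sum_image fun i _ j _ hij ↦ hcmono.injective hij]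
    exact Finset.sum_le_sum fun i _ ↦ by linarith [(hc i).2.1]

/-- **Turing's method from below, fed by sign changes.** For `0 ≤ T − h`, `0 ≤ h`, strict sign
changes of `Z` along `T − h ≤ s_0 < ⋯ < s_m ≤ T`, a bound `−B ≤ ∫_{T−h}^{T} S`, and
`h · n < Σ_{j<m} (s_j − (T − h)) + ∫_{T−h}^{T} (θ/π + 1) − B`, one has `n < N(T)`.
[cite: Brent1979, Thm. 3.2] -/
theorem lt_zetaZeroCount_of_sign_changes_below {T h B : ℝ} {n m : ℕ} (hTh : 0 ≤ T - h)
    (hh : 0 ≤ h)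
    (s : Fin (m + 1) → ℝ) (hs : StrictMono s) (hs0 : T - h ≤ s 0) (hsm : s (Fin.last m) ≤ T)
    (hssign : ∀ i : Fin m, hardyZ (s i.castSucc) * hardyZ (s i.succ) < 0)
    (hS : -B ≤ ∫ t in (T - h)..T, zetaArgS t)
    (hnum : h * n < ∑ i : Fin m, (s i.castSucc - (T - h))
        + (∫ t in (T - h)..T, (riemannSiegelTheta t / π + 1)) - B) :
    n < zetaZeroCount T := by
  obtain ⟨Z, hZ, hsum⟩ := exists_finset_zeros_below_of_sign_changes s hs hs0 hsm hssign
  exact lt_zetaZeroCount_of_turing_lower hTh hh Z hZ hS (by linarith)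

/-! ### Window certificates: the exact count at one height -/

/-- **Window certificate (Turing's method at both sides of one height).** Let `A` bound
`|∫_{t₁}^{t₂} S|` by `A(t₂)` whenever `c < t₁ < t₂` (the shape of `abs_integral_zetaArgS_le_turing`,
`abs_integral_zetaArgS_le_trudgian`, `abs_integral_zetaArgS_le_trudgianII`). Suppose `c < T − h'`,
`0 ≤ T − h'`, `0 < h`, `0 < h'`, and that Hardy's `Z` has `m` strict sign changes along
`T ≤ s_0 < ⋯ < s_m ≤ T + h` and `m'` strict sign changes along `T − h' ≤ s'_0 < ⋯ < s'_{m'} ≤ T`.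
If `A(T + h) + ∫_T^{T+h} (θ/π + 1) − Σ_{j<m} (T + h − s_{j+1}) < h (n + 1)` and
`h' (n − 1) < Σ_{j<m'} (s'_j − (T − h')) + ∫_{T−h'}^{T} (θ/π + 1) − A(T)`, then `N(T) = n`.
No information about the zeros below `T − h'` enters. [cite: Brent1979, Thm. 3.2] -/
theorem zetaZeroCount_eq_of_turing_window {A : ℝ → ℝ} {c T h h' : ℝ} {n m m' : ℕ}
    (hA : ∀ ⦃t₁ t₂ : ℝ⦄, c < t₁ → t₁ < t₂ → |∫ t in t₁..t₂, zetaArgS t| ≤ A t₂)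
    (hc : c < T - h') (hT : 0 ≤ T - h') (hh : 0 < h) (hh' : 0 < h')
    (s : Fin (m + 1) → ℝ) (hs : StrictMono s) (hs0 : T ≤ s 0) (hsm : s (Fin.last m) ≤ T + h)
    (hssign : ∀ i : Fin m, hardyZ (s i.castSucc) * hardyZ (s i.succ) < 0)
    (s' : Fin (m' + 1) → ℝ) (hs' : StrictMono s') (hs'0 : T - h' ≤ s' 0)
    (hs'm : s' (Fin.last m') ≤ T)
    (hs'sign : ∀ i : Fin m', hardyZ (s' i.castSucc) * hardyZ (s' i.succ) < 0)
    (hup : A (T + h) + (∫ t in T..T + h, (riemannSiegelTheta t / π + 1))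
        - ∑ i : Fin m, (T + h - s i.succ) < h * (n + 1))
    (hlow : h' * ((n : ℝ) - 1) < ∑ i : Fin m', (s' i.castSucc - (T - h'))
        + (∫ t in (T - h')..T, (riemannSiegelTheta t / π + 1)) - A T) :
    zetaZeroCount T = n := by
  have hT0 : 0 ≤ T := hT.trans (by linarith)
  -- upper half: N(T) ≤ n
  obtain ⟨Z, hZ, hsum⟩ := exists_finset_zeros_above_of_sign_changes s hs hs0 hsm hssign
  have hSup : ∫ t in T..T + h, zetaArgS t ≤ A (T + h) :=
    (abs_le.1 (hA (by linarith) (by linarith : T < T + h))).2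
  have hup' : zetaZeroCount T ≤ n :=
    zetaZeroCount_le_of_turing hT0 hh.le Z hZ hSup (by linarith)
  -- lower half: n - 1 < N(T), i.e. n ≤ N(T)
  have hSlow : -A T ≤ ∫ t in (T - h')..T, zetaArgS t :=
    (abs_le.1 (hA hc (by linarith : T - h' < T))).1
  rcases Nat.eq_zero_or_pos n with hn0 | hnpos
  · omega
  · obtain ⟨k, rfl⟩ : ∃ k, n = k + 1 := ⟨n - 1, by omega⟩
    have hcast : ((k + 1 : ℕ) : ℝ) - 1 = (k : ℝ) := by push_cast; ring
    rw [hcast] at hlow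
    have hlow' : k < zetaZeroCount T :=
      lt_zetaZeroCount_of_sign_changes_below hT hh'.le s' hs' hs'0 hs'm hs'sign hSlow hlow
    omega

/-- **Window certificate with Trudgian's 2011 bound.** `zetaZeroCount_eq_of_turing_window` with
`A(t) = 2.067 + 0.059 log t` and threshold `168π` (Trudgian 2011, Thm. 2.2, the named fact
`abs_integral_zetaArgS_le_trudgian`, taken as a hypothesis): sign changes of `Z` in `[T − h', T + h]`
and two explicit real inequalities give `N(T) = n`. [cite: Trudgian2011, Thm. 2.2] -/
theorem zetaZeroCount_eq_of_turing_window_trudgian (hTr : abs_integral_zetaArgS_le_trudgian)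
    {T h h' : ℝ} {n m m' : ℕ} (hc : 168 * π < T - h') (hh : 0 < h) (hh' : 0 < h')
    (s : Fin (m + 1) → ℝ) (hs : StrictMono s) (hs0 : T ≤ s 0) (hsm : s (Fin.last m) ≤ T + h)
    (hssign : ∀ i : Fin m, hardyZ (s i.castSucc) * hardyZ (s i.succ) < 0)
    (s' : Fin (m' + 1) → ℝ) (hs' : StrictMono s') (hs'0 : T - h' ≤ s' 0)
    (hs'm : s' (Fin.last m') ≤ T)
    (hs'sign : ∀ i : Fin m', hardyZ (s' i.castSucc) * hardyZ (s' i.succ) < 0)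
    (hup : 2.067 + 0.059 * Real.log (T + h) + (∫ t in T..T + h, (riemannSiegelTheta t / π + 1))
        - ∑ i : Fin m, (T + h - s i.succ) < h * (n + 1))
    (hlow : h' * ((n : ℝ) - 1) < ∑ i : Fin m', (s' i.castSucc - (T - h'))
        + (∫ t in (T - h')..T, (riemannSiegelTheta t / π + 1)) - (2.067 + 0.059 * Real.log T)) :
    zetaZeroCount T = n := by
  have hT : 0 ≤ T - h' := le_of_lt (lt_trans (by positivity) hc)
  exact zetaZeroCount_eq_of_turing_window (A := fun t ↦ 2.067 + 0.059 * Real.log t)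
    (fun t₁ t₂ h1 h2 ↦ hTr h1 h2) hc hT hh hh' s hs hs0 hsm hssign s' hs' hs'0 hs'm hs'sign hup hlow

end Literature.NumberTheory.LFunctions
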